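import Mathlib
import Summits.Ventures.PercRepro2.Star3Pins

/-!
# THE THREE-PIN STAR: the connectivity readings of the eight worlds (blind cell PercRepro2, night-1 g27;
proofs/NIGHT1-G26.md §7 (1))

For `a₃` with exactly the three edges `g = {a₃, o}`, `e = {a₃, a₁}`, `d = {a₃, a₂}` (`hstar3`), the connections of
each world `ω[g ↦ c₁][e ↦ c₂][d ↦ c₃]` read on the base configuration `ω₀ = ω[g ↦ 0][e ↦ 0][d ↦ 0]`, in which `a₃`
is isolated (`iso_base`): a leaf at `o` / `a₁` / `a₂` (`r100`, `r100a`, `r010`, `r001`, …), `a₃ ≡ a₁ ≡ o` reads on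
the base with the `o`-edge `f = {o, a₁}` OPENED (`r110`, `r110a`, as in g24's world `(1, 1)`), `a₃ ≡ a₂ ≡ o` reads
with an extra `o`–`a₂` connection (`r101`, `r101a`), and with `e`, `d` both open `a₁ ↔ a₂` (`conn_a1_a2_011`,
`conn_a1_a2_111`).  Own code, from g24's iso readings (MixChordOStar3Conn.lean); standard axioms.
-/

namespace Summit.Ventures.PercRepro2

open UnionCluster CovForm

namespace Mix

open OStar

namespace OStar3

/-! ## The readings of the eight worlds on the base configuration -/

section Readings

variable {V : Type*} {E : Type*} [DecidableEq E] {ends : E → Sym2 V} {g e d f : E} {o a₁ a₂ a₃ : V}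

variable (hg : ends g = s(a₃, o)) (he : ends e = s(a₃, a₁)) (hd : ends d = s(a₃, a₂))
  (hstar3 : ∀ e', a₃ ∈ ends e' → e' = g ∨ e' = e ∨ e' = d) (hf : ends f = s(o, a₁))
  (hge : g ≠ e) (hgd : g ≠ d) (hed : e ≠ d) (hgf : g ≠ f) (hef : e ≠ f) (hdf : d ≠ f)

include hstar3 hge hgd hed in
/-- `a₃` is isolated in the base configuration. -/
lemma iso_base (ω : Config E) :
    ∀ x, x ≠ a₃ → ¬ Conn ends (Function.update (Function.update (Function.update ω g false) e false) d false) x a₃ :=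
  fun _ hx => not_conn_a3_of_closed3 hstar3 (base3_g hge hgd ω) (base3_e hed ω) (base3_d ω) hx

include hstar3 hge hgd hed in
/-- World `(0, 0, 0)`: `a₃` is isolated. -/
lemma r000a (ω : Config E) {x : V} (hx : x ≠ a₃) :
    Conn ends (Function.update (Function.update (Function.update ω g false) e false) d false) x a₃ ↔ False :=
  iff_false_intro (iso_base hstar3 hge hgd hed ω x hx)

include hstar3 hge hgd hed in
/-- World `(0, 0, 0)`: `a₃` is isolated (other orientation). -/
lemma r000a' (ω : Config E) {x : V} (hx : x ≠ a₃) :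
    Conn ends (Function.update (Function.update (Function.update ω g false) e false) d false) a₃ x ↔ False :=
  iff_false_intro fun h => iso_base hstar3 hge hgd hed ω x hx (conn_symm h)

include hg hstar3 hge hgd hed in
/-- World `(1, 0, 0)`: connections among vertices other than `a₃` read on the base configuration. -/
lemma r100 (ω : Config E) {x y : V} (hx : x ≠ a₃) (hy : y ≠ a₃) :
    Conn ends (Function.update (Function.update (Function.update ω g true) e false) d false) x y ↔
      Conn ends (Function.update (Function.update (Function.update ω g false) e false) d false) x y := by
  rw [upd100 hge hgd]
  exact conn_update_iff_of_iso hg (base3_g hge hgd ω) (iso_base hstar3 hge hgd hed ω) hx hy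

include hg hstar3 hge hgd hed in
/-- World `(1, 0, 0)`: `x ↔ a₃` reads as `x ↔ o`. -/
lemma r100a (ω : Config E) {x : V} (hx : x ≠ a₃) :
    Conn ends (Function.update (Function.update (Function.update ω g true) e false) d false) x a₃ ↔
      Conn ends (Function.update (Function.update (Function.update ω g false) e false) d false) x o := by
  rw [upd100 hge hgd]
  exact conn_a3_update_iff_of_iso hg (base3_g hge hgd ω) (iso_base hstar3 hge hgd hed ω) hx

include hg hstar3 hge hgd hed in
/-- World `(1, 0, 0)`: `a₃ ↔ x` reads as `o ↔ x`. -/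
lemma r100a' (ω : Config E) {x : V} (hx : x ≠ a₃) :
    Conn ends (Function.update (Function.update (Function.update ω g true) e false) d false) a₃ x ↔
      Conn ends (Function.update (Function.update (Function.update ω g false) e false) d false) o x := by
  rw [← (⟨conn_symm, conn_symm⟩ : Conn ends _ x a₃ ↔ Conn ends _ a₃ x), r100a hg hstar3 hge hgd hed ω hx]
  exact ⟨conn_symm, conn_symm⟩

include he hstar3 hge hgd hed in
/-- World `(0, 1, 0)`: connections among vertices other than `a₃` read on the base configuration. -/
lemma r010 (ω : Config E) {x y : V} (hx : x ≠ a₃) (hy : y ≠ a₃) :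
    Conn ends (Function.update (Function.update (Function.update ω g false) e true) d false) x y ↔
      Conn ends (Function.update (Function.update (Function.update ω g false) e false) d false) x y := by
  rw [upd010 hed]
  exact conn_update_iff_of_iso he (base3_e hed ω) (iso_base hstar3 hge hgd hed ω) hx hy

include he hstar3 hge hgd hed in
/-- World `(0, 1, 0)`: `x ↔ a₃` reads as `x ↔ a₁`. -/
lemma r010a (ω : Config E) {x : V} (hx : x ≠ a₃) :
    Conn ends (Function.update (Function.update (Function.update ω g false) e true) d false) x a₃ ↔
      Conn ends (Function.update (Function.update (Function.update ω g false) e false) d false) x a₁ := by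
  rw [upd010 hed]
  exact conn_a3_update_iff_of_iso he (base3_e hed ω) (iso_base hstar3 hge hgd hed ω) hx

include he hstar3 hge hgd hed in
/-- World `(0, 1, 0)`: `a₃ ↔ x` reads as `a₁ ↔ x`. -/
lemma r010a' (ω : Config E) {x : V} (hx : x ≠ a₃) :
    Conn ends (Function.update (Function.update (Function.update ω g false) e true) d false) a₃ x ↔
      Conn ends (Function.update (Function.update (Function.update ω g false) e false) d false) a₁ x := by
  rw [← (⟨conn_symm, conn_symm⟩ : Conn ends _ x a₃ ↔ Conn ends _ a₃ x), r010a he hstar3 hge hgd hed ω hx]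
  exact ⟨conn_symm, conn_symm⟩

include hd hstar3 hge hgd hed in
/-- World `(0, 0, 1)`: connections among vertices other than `a₃` read on the base configuration. -/
lemma r001 (ω : Config E) {x y : V} (hx : x ≠ a₃) (hy : y ≠ a₃) :
    Conn ends (Function.update (Function.update (Function.update ω g false) e false) d true) x y ↔
      Conn ends (Function.update (Function.update (Function.update ω g false) e false) d false) x y := by
  rw [upd001]
  exact conn_update_iff_of_iso hd (base3_d ω) (iso_base hstar3 hge hgd hed ω) hx hy

include hd hstar3 hge hgd hed in
/-- World `(0, 0, 1)`: `x ↔ a₃` reads as `x ↔ a₂`. -/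
lemma r001a (ω : Config E) {x : V} (hx : x ≠ a₃) :
    Conn ends (Function.update (Function.update (Function.update ω g false) e false) d true) x a₃ ↔
      Conn ends (Function.update (Function.update (Function.update ω g false) e false) d false) x a₂ := by
  rw [upd001]
  exact conn_a3_update_iff_of_iso hd (base3_d ω) (iso_base hstar3 hge hgd hed ω) hx

include hd hstar3 hge hgd hed in
/-- World `(0, 0, 1)`: `a₃ ↔ x` reads as `a₂ ↔ x`. -/
lemma r001a' (ω : Config E) {x : V} (hx : x ≠ a₃) :
    Conn ends (Function.update (Function.update (Function.update ω g false) e false) d true) a₃ x ↔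
      Conn ends (Function.update (Function.update (Function.update ω g false) e false) d false) a₂ x := by
  rw [← (⟨conn_symm, conn_symm⟩ : Conn ends _ x a₃ ↔ Conn ends _ a₃ x), r001a hd hstar3 hge hgd hed ω hx]
  exact ⟨conn_symm, conn_symm⟩

include hg hd hstar3 hge hgd hed in
/-- World `(1, 0, 1)` (`a₃ ≡ a₂ ≡ o`): the other vertices are connected as in the base with an extra `o`–`a₂`
connection. -/
lemma r101 (h23 : a₂ ≠ a₃) (ω : Config E) {x y : V} (hx : x ≠ a₃) (hy : y ≠ a₃) :
    Conn ends (Function.update (Function.update (Function.update ω g true) e false) d true) x y ↔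
      Conn ends (Function.update (Function.update (Function.update ω g false) e false) d false) x y ∨
        (Conn ends (Function.update (Function.update (Function.update ω g false) e false) d false) x o ∧
          Conn ends (Function.update (Function.update (Function.update ω g false) e false) d false) a₂ y) ∨
        (Conn ends (Function.update (Function.update (Function.update ω g false) e false) d false) x a₂ ∧
          Conn ends (Function.update (Function.update (Function.update ω g false) e false) d false) o y) := by
  rw [upd101 hge hgd]
  exact conn_update2_iff_of_iso hg hd hgd (base3_g hge hgd ω) (base3_d ω) (iso_base hstar3 hge hgd hed ω) h23 hx hy

include hg hd hstar3 hge hgd hed in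
/-- World `(1, 0, 1)`: `x ↔ a₃` reads as `x ↔ o ∨ x ↔ a₂`. -/
lemma r101a (h23 : a₂ ≠ a₃) (ω : Config E) {x : V} (hx : x ≠ a₃) :
    Conn ends (Function.update (Function.update (Function.update ω g true) e false) d true) x a₃ ↔
      Conn ends (Function.update (Function.update (Function.update ω g false) e false) d false) x o ∨
        Conn ends (Function.update (Function.update (Function.update ω g false) e false) d false) x a₂ := by
  rw [upd101 hge hgd]
  exact conn_a3_update2_iff_of_iso hg hd hgd (base3_g hge hgd ω) (base3_d ω) (iso_base hstar3 hge hgd hed ω) h23 hx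

include hg hd hstar3 hge hgd hed in
/-- World `(1, 0, 1)`: `a₃ ↔ x` reads as `o ↔ x ∨ a₂ ↔ x`. -/
lemma r101a' (h23 : a₂ ≠ a₃) (ω : Config E) {x : V} (hx : x ≠ a₃) :
    Conn ends (Function.update (Function.update (Function.update ω g true) e false) d true) a₃ x ↔
      Conn ends (Function.update (Function.update (Function.update ω g false) e false) d false) o x ∨
        Conn ends (Function.update (Function.update (Function.update ω g false) e false) d false) a₂ x := by
  rw [← (⟨conn_symm, conn_symm⟩ : Conn ends _ x a₃ ↔ Conn ends _ a₃ x), r101a hg hd hstar3 hge hgd hed h23 ω hx]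
  exact or_congr ⟨conn_symm, conn_symm⟩ ⟨conn_symm, conn_symm⟩

/-! ### World `(1, 1, 0)` (`a₃ ≡ a₁ ≡ o`): reads on the base configuration with the `o`-edge `f` opened -/

include hg he hstar3 hf hge hgd hed hgf hef hdf in
/-- World `(1, 1, 0)`: connections among vertices other than `a₃` read on the base with `f` opened. -/
lemma r110 (ω : Config E) {x y : V} (hx : x ≠ a₃) (hy : y ≠ a₃) :
    Conn ends (Function.update (Function.update (Function.update ω g true) e true) d false) x y ↔
      Conn ends (Function.update (Function.update (Function.update (Function.update ω g false) e false) d false)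
        f true) x y := by
  rw [upd110 hge hgd hed, conn_update_ge_iff_f hg he hf hge hgf hef x y, update_gef_eq hgf hef]
  -- `e` is redundant in `ω₀[f ↦ 1][g ↦ 1]`
  have hcl : Function.update (Function.update (Function.update (Function.update (Function.update (Function.update ω
      g false) e false) d false) f true) g true) e false =
      Function.update (Function.update (Function.update (Function.update (Function.update ω g false) e false) d false)
        f true) g true := by
    rw [Function.update_eq_self_iff, Function.update_of_ne hge.symm, Function.update_of_ne hef, base3_e hed]
  have h3 : Conn ends (Function.update (Function.update (Function.update (Function.update (Function.update
      (Function.update ω g false) e false) d false) f true) g true) e false) a₃ a₁ := by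
    rw [hcl]; exact conn_a3_a1_fg hg hf hgf
  rw [conn_update_iff_of_conn he h3 true x y, hcl]
  -- `a₃` is a leaf at `o` in `ω₀[f ↦ 1][g ↦ 1]`
  have hg' : Function.update (Function.update (Function.update (Function.update ω g false) e false) d false) f true
      g = false := by rw [Function.update_of_ne hgf, base3_g hge hgd]
  have hiso : ∀ z, z ≠ a₃ → ¬ Conn ends (Function.update (Function.update (Function.update (Function.update ω
      g false) e false) d false) f true) z a₃ := fun _ hz =>
    not_conn_a3_of_closed3 hstar3 hg' (by rw [Function.update_of_ne hef, base3_e hed])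
      (by rw [Function.update_of_ne hdf, base3_d]) hz
  exact conn_update_iff_of_iso hg hg' hiso hx hy

include hg he hstar3 hf hge hgd hed hgf hef hdf in
/-- World `(1, 1, 0)`: `x ↔ a₃` reads as `x ↔ a₁` on the base with `f` opened. -/
lemma r110a (h13 : a₁ ≠ a₃) (ω : Config E) {x : V} (hx : x ≠ a₃) :
    Conn ends (Function.update (Function.update (Function.update ω g true) e true) d false) x a₃ ↔
      Conn ends (Function.update (Function.update (Function.update (Function.update ω g false) e false) d false)
        f true) x a₁ := by
  rw [upd110 hge hgd hed, conn_update_ge_iff_f hg he hf hge hgf hef x a₃, update_gef_eq hgf hef]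
  have hcl : Function.update (Function.update (Function.update (Function.update (Function.update (Function.update ω
      g false) e false) d false) f true) g true) e false =
      Function.update (Function.update (Function.update (Function.update (Function.update ω g false) e false) d false)
        f true) g true := by
    rw [Function.update_eq_self_iff, Function.update_of_ne hge.symm, Function.update_of_ne hef, base3_e hed]
  have h3 : Conn ends (Function.update (Function.update (Function.update (Function.update (Function.update
      (Function.update ω g false) e false) d false) f true) g true) e false) a₃ a₁ := by
    rw [hcl]; exact conn_a3_a1_fg hg hf hgf
  have hea : Conn ends (Function.update (Function.update (Function.update (Function.update (Function.update
      (Function.update ω g false) e false) d false) f true) g true) e true) a₃ a₁ :=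
    conn_of_openAdj ⟨e, by simp, he⟩
  have step : Conn ends (Function.update (Function.update (Function.update (Function.update (Function.update
      (Function.update ω g false) e false) d false) f true) g true) e true) x a₃ ↔
      Conn ends (Function.update (Function.update (Function.update (Function.update (Function.update
        (Function.update ω g false) e false) d false) f true) g true) e true) x a₁ :=
    ⟨fun h => conn_trans h hea, fun h => conn_trans h (conn_symm hea)⟩
  rw [step, conn_update_iff_of_conn he h3 true x a₁, hcl]
  have hg' : Function.update (Function.update (Function.update (Function.update ω g false) e false) d false) f true
      g = false := by rw [Function.update_of_ne hgf, base3_g hge hgd]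
  have hiso : ∀ z, z ≠ a₃ → ¬ Conn ends (Function.update (Function.update (Function.update (Function.update ω
      g false) e false) d false) f true) z a₃ := fun _ hz =>
    not_conn_a3_of_closed3 hstar3 hg' (by rw [Function.update_of_ne hef, base3_e hed])
      (by rw [Function.update_of_ne hdf, base3_d]) hz
  exact conn_update_iff_of_iso hg hg' hiso hx h13

include hg he hstar3 hf hge hgd hed hgf hef hdf in
/-- World `(1, 1, 0)`: `a₃ ↔ x` reads as `a₁ ↔ x` on the base with `f` opened. -/
lemma r110a' (h13 : a₁ ≠ a₃) (ω : Config E) {x : V} (hx : x ≠ a₃) :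
    Conn ends (Function.update (Function.update (Function.update ω g true) e true) d false) a₃ x ↔
      Conn ends (Function.update (Function.update (Function.update (Function.update ω g false) e false) d false)
        f true) a₁ x := by
  rw [← (⟨conn_symm, conn_symm⟩ : Conn ends _ x a₃ ↔ Conn ends _ a₃ x),
    r110a hg he hstar3 hf hge hgd hed hgf hef hdf h13 ω hx]
  exact ⟨conn_symm, conn_symm⟩

/-! ### Worlds `(0, 1, 1)` and `(1, 1, 1)`: `a₁ ↔ a₂` -/

include he hd hed in
/-- World `(0, 1, 1)`: `a₁ ↔ a₂`. -/
lemma conn_a1_a2_011 (ω : Config E) :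
    Conn ends (Function.update (Function.update (Function.update ω g false) e true) d true) a₁ a₂ :=
  conn_a1_a2_of_ed he hd (by rw [Function.update_of_ne hed]; simp) (by simp)

include he hd hed in
/-- World `(1, 1, 1)`: `a₁ ↔ a₂`. -/
lemma conn_a1_a2_111 (ω : Config E) :
    Conn ends (Function.update (Function.update (Function.update ω g true) e true) d true) a₁ a₂ :=
  conn_a1_a2_of_ed he hd (by rw [Function.update_of_ne hed]; simp) (by simp)

end Readings

end OStar3

end Mix

end Summit.Ventures.PercRepro2
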